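import Literature.AlgebraicGeometry.Resolution.ProperModelsJoin
import HarnessLib

/-!
# Proper modifications of proper models are proper models

Topic: `Literature/AlgebraicGeometry/Resolution`. The PROPER-model twin of
`ProjectiveModelsModification.lean`: for a proper model `M` of `K/k` (`ProperModels.lean`), an
integral scheme `X''` and a PROPER `ρ : X'' → M` which is an isomorphism over a non-empty open
`U ⊆ M`, the `k`-scheme `(X'', ρ ≫ π_M)` with `K`-point the lift of `gen_M` through `ρ⁻¹(U) ≅ U`
is a proper model dominating `M` (Piltant 2013, proof of Prop. 5.1, Steps 2, 4, 5: blowing ups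
and glued models of a proper model are proper models). Everything is PROVED:

* `ProperModel.genLift`, `invOver`, `genOfModification` — the `K`-point of the modification;
* `ProperModel.ofModification`, `ofModificationHom` — the modification model and its domination;
* `ProperModel.exists_properModel_of_isBirational` — existence form from `IsBirational ρ`.

## References

* O. Piltant, RACSAM 107 (2013), Prop. 5.1 (proof, Steps 2, 4 and 5). [Piltant2013]
* O. Zariski, P. Samuel, *Commutative Algebra* II, Ch. VI §17. [ZariskiSamuel1960]
-/

noncomputable section

open CategoryTheory AlgebraicGeometry TopologicalSpace IsLocalRing

namespace Literature.AlgebraicGeometry.Resolution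

universe u

namespace ProperModel

variable {k K : Type u} [Field k] [Field K] [Algebra k K]

section Modification

variable (M : ProperModel k K) {X'' : Scheme.{u}} (ρ : X'' ⟶ M.X)
  (U : M.X.Opens) (hU : (U : Set M.X).Nonempty)

/-- The generic point of `M` lies in every non-empty open. [folklore] -/
theorem genericPoint_mem {U : M.X.Opens} (hU : (U : Set M.X).Nonempty) : genericPoint M.X ∈ U := by
  obtain ⟨x, hx⟩ := hU
  exact ((genericPoint_spec M.X).mem_open_set_iff U.isOpen).2 ⟨x, Set.mem_univ _, hx⟩

/-- The `K`-point `gen_M` factors through every non-empty open `U`. [folklore] -/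
theorem range_gen_subset {U : M.X.Opens} (hU : (U : Set M.X).Nonempty) :
    Set.range M.gen ⊆ Set.range U.ι := by
  rw [Scheme.Opens.range_ι, range_gen]
  exact Set.singleton_subset_iff.mpr (M.genericPoint_mem hU)

/-- The lift `Spec K → U` of `gen_M` into a non-empty open `U`. [folklore] -/
def genLift {U : M.X.Opens} (hU : (U : Set M.X).Nonempty) : Spec (CommRingCat.of K) ⟶ U :=
  IsOpenImmersion.lift U.ι M.gen (M.range_gen_subset hU)

/-- `genLift ≫ (U ↪ M) = gen_M`. [folklore] -/
@[reassoc (attr := simp)]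
theorem genLift_ι {U : M.X.Opens} (hU : (U : Set M.X).Nonempty) : M.genLift hU ≫ U.ι = M.gen :=
  IsOpenImmersion.lift_fac _ _ _

/-- `𝒪_{U,ξ} → K` is an isomorphism for the lifted `K`-point. [folklore] -/
instance isIso_stalkClosedPointTo_genLift {U : M.X.Opens} (hU : (U : Set M.X).Nonempty) :
    IsIso (Scheme.stalkClosedPointTo (M.genLift hU)) := by
  have h : IsIso (Scheme.stalkClosedPointTo (M.genLift hU ≫ U.ι)) := by
    rw [genLift_ι]; infer_instance
  rw [Scheme.stalkClosedPointTo_comp] at h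
  have e : Scheme.stalkClosedPointTo (M.genLift hU) = inv (U.ι.stalkMap _) ≫
      (U.ι.stalkMap ((M.genLift hU) (closedPoint K)) ≫ Scheme.stalkClosedPointTo (M.genLift hU)) := by
    rw [IsIso.inv_hom_id_assoc]
  rw [e]
  exact IsIso.comp_isIso' inferInstance h

variable [IsIso (ρ ∣_ U)]

/-- The inverse `U ≅ ρ⁻¹(U)` followed by `ρ⁻¹(U) ↪ X''`. [folklore] -/
def invOver : (U : Scheme.{u}) ⟶ X'' :=
  inv (ρ ∣_ U) ≫ (ρ ⁻¹ᵁ U).ι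

/-- `invOver ≫ ρ = U ↪ M`. [folklore] -/
@[reassoc (attr := simp)]
theorem invOver_ρ : invOver M ρ U ≫ ρ = U.ι := by
  rw [invOver, Category.assoc, ← morphismRestrict_ι, IsIso.inv_hom_id_assoc]

/-- `invOver` is an open immersion. [folklore] -/
instance isOpenImmersion_invOver : IsOpenImmersion (invOver M ρ U) := by
  unfold invOver; infer_instance

/-- The `K`-point of the modification: `gen_M` lifted through `ρ⁻¹(U) ≅ U`. [folklore] -/
def genOfModification : Spec (CommRingCat.of K) ⟶ X'' :=
  M.genLift hU ≫ invOver M ρ U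

/-- The `K`-point of the modification lies over `gen_M`. [folklore] -/
@[reassoc (attr := simp)]
theorem genOfModification_ρ : genOfModification M ρ U hU ≫ ρ = M.gen := by
  rw [genOfModification, Category.assoc, invOver_ρ, genLift_ι]

variable [IsIntegral X'']

/-- The `K`-point of the modification hits the generic point of `X''`. [folklore] -/
theorem genOfModification_closedPoint :
    genOfModification M ρ U hU (closedPoint K) = genericPoint X'' := by
  haveI : Nonempty (U : Scheme.{u}) := ⟨M.genLift hU (closedPoint K)⟩
  haveI : IsIntegral (U : Scheme.{u}) := isIntegral_of_isOpenImmersion U.ι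
  have h1 : M.genLift hU (closedPoint K) = genericPoint (U : Scheme.{u}) :=
    eq_genericPoint_of_comp_ι U (M.genLift hU) (M.genLift_ι hU)
  rw [genOfModification, Scheme.Hom.comp_apply, h1]
  exact genericPoint_eq_of_isOpenImmersion (invOver M ρ U)

omit [IsIntegral X''] in
/-- `𝒪_{X'',ξ} → K` is an isomorphism for the `K`-point of the modification. [folklore] -/
instance isIso_stalkClosedPointTo_genOfModification :
    IsIso (Scheme.stalkClosedPointTo (genOfModification M ρ U hU)) := by
  have h1 : ∀ x, IsIso ((invOver M ρ U).stalkMap x) := fun x => inferInstance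
  rw [genOfModification, Scheme.stalkClosedPointTo_comp]
  exact IsIso.comp_isIso' (h1 _) (isIso_stalkClosedPointTo_genLift M hU)

variable [IsProper ρ]

/-- **The modification model.** For a proper model `M` of `K/k`, an integral `X''` and a proper
`ρ : X'' → M` which is an isomorphism over a non-empty open `U ⊆ M`, the proper model
`(X'', ρ ≫ π_M)` of `K/k` with `K`-point the lift of `gen_M` (Piltant 2013, proof of Prop. 5.1:
the modified and glued models are again proper models of `K`).
[cite: Piltant2013, Prop. 5.1 (proof, Steps 2, 4 and 5)] -/
def ofModification : ProperModel k K where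
  X := X''
  π := ρ ≫ M.π
  gen := genOfModification M ρ U hU
  gen_π := by rw [genOfModification_ρ_assoc, M.gen_π]
  isIntegral := inferInstance
  isProper := inferInstance
  genericPt_eq := genOfModification_closedPoint M ρ U hU
  isIso_stalkClosedPointTo := inferInstance

/-- The underlying scheme of the modification model is `X''`. [folklore] -/
@[simp] theorem ofModification_X : (ofModification M ρ U hU).X = X'' := rfl

/-- The structure morphism of the modification model. [folklore] -/
@[simp] theorem ofModification_π : (ofModification M ρ U hU).π = ρ ≫ M.π := rfl

/-- The `K`-point of the modification model. [folklore] -/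
@[simp] theorem ofModification_gen :
    (ofModification M ρ U hU).gen = genOfModification M ρ U hU := rfl

/-- **The modification dominates the model**: `ρ` as a morphism of proper models.
[cite: Piltant2013, Prop. 5.1 (proof, Step 2)] -/
def ofModificationHom : (ofModification M ρ U hU).Hom M where
  f := ρ
  f_π := rfl
  gen_f := genOfModification_ρ M ρ U hU

/-- The underlying morphism of `ofModificationHom` is `ρ`. [folklore] -/
@[simp] theorem ofModificationHom_f : (ofModificationHom M ρ U hU).f = ρ := rfl

end Modification

/-! ## From `IsBirational` -/

/-- A birational morphism to a proper model is an isomorphism over some non-empty open.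
[folklore] -/
theorem exists_nonempty_isIso_morphismRestrict (M : ProperModel k K) {X'' : Scheme.{u}}
    {ρ : X'' ⟶ M.X} (hρ : IsBirational ρ) :
    ∃ U : M.X.Opens, (U : Set M.X).Nonempty ∧ IsIso (ρ ∣_ U) := by
  obtain ⟨U, hUd, -, hiso⟩ := hρ
  exact ⟨U, hUd.nonempty, hiso⟩

/-- **A proper birational modification of a proper model is a proper model dominating it**: for
an integral `X''` and a proper birational `ρ : X'' → M` there is a proper model `N` of `K/k` with
underlying scheme `X''` and a morphism of models `N → M` with underlying morphism `ρ`.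
[cite: Piltant2013, Prop. 5.1 (proof, Step 2)] -/
theorem exists_properModel_of_isBirational (M : ProperModel k K) {X'' : Scheme.{u}} [IsIntegral X'']
    (ρ : X'' ⟶ M.X) [IsProper ρ] (hρ : IsBirational ρ) :
    ∃ (N : ProperModel k K) (φ : N.Hom M) (e : N.X = X''), φ.f = eqToHom e ≫ ρ := by
  obtain ⟨U, hU, hiso⟩ := M.exists_nonempty_isIso_morphismRestrict hρ
  haveI := hiso
  exact ⟨ofModification M ρ U hU, ofModificationHom M ρ U hU, rfl, by simp⟩

end ProperModel

end Literature.AlgebraicGeometry.Resolution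

end
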